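/-
Copyright: the b2b-balaban T⁴-continuum CRUX team, row NE7b, leaf lineage `t4-ne7b-formalise-leaf-02` (gen 132). Project licence.
-/
import Summits.QuantumFields.BalabanUV.T4Continuum.Spine.NE7b.SqrtFormPerturbationLetters
import Summits.QuantumFields.BalabanUV.T4Continuum.Spine.NE7b.TorusPlaquetteIncidence
import Mathlib.Tactic.Linarith
import Mathlib.Tactic.Positivity
import Mathlib.Tactic.Ring

/-!
# THE MAIN-PART ∕ REMAINDER SPLIT OF THE AVERAGED CURL FORM (Prop. 5.4, first display): from the (5.2) letter of the MAIN PART `M_k`,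
# the (R-M) letter of the REMAINDER `E_k = Q_k − M_k` and the locality of the unit-lattice curl, the covariant-Stokes-plus-(R-M) letter
# `F(QA) ≤ p·Dsq A + q·NΩ A` of `…CurlFormEnergyDomination.h1_of_letters` with `p = 2p_M`, `q = 2q_M + 2ℓ²ab·c_E` — print's `p = 16` from
# `p_M = 8`, and `q ≤ c₃ε_F²`; the counts `a = 4`, `b = 2(d−1)` on the unit torus BY NAME (row NE7b, node U5c; the (h1) slot of print's `γ₀`
# assembly, `HOME/b2b-balaban-r1/SectE-interface-proof.md` §5.4; companion of `…CovariantStokesCounting` ∕ `…BlockSurfaceMultiplicity` ∕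
# `…BlockSurfaceCounting` (the (5.2) letter) and of `…CurlFormEnergyDomination` (the consumer))

Cell `pub-balaban`, sub-cell `t4`, spine estimate NE7b (`T4WeightBudget.RelWeightBound`; the cell's OWN estimate — NOT PRINTED in
[Bałaban 1983–89], NOT PROVED).  Crux-route work under `Spine/NE7b/` by the row's E-side ∕ key-readings ∕ lattice-geometry leaf lineage; NOTHING
of Bałaban's is named or asserted; no `T4Continuum/Support` leaf typed; no `def`, no notation; zero `sorry`.  Imports: Mathlib + two row modules
with hub oleans, REUSED BY NAME and not restated: `…SqrtFormPerturbationLetters` (leaf-05 g153: `pert_letter_of_local` — Cauchy–Schwarz + double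
counting `Σ_p (f_p − g_p)² ≤ η²ab‖B‖²`) and this lineage's `…TorusPlaquetteIncidence` (gen 131: `card_plaquettes_through_bond_le` — `2(d−1)`
plaquettes per bond on `(ℤ∕N)^d`).

WHY (located).  The memo's Prop. 5.4 ((h1)), first display: «For all fine `A`, with `B := Q_k(U)A` on `Λ_k`:
`F(QA) = Σ_P|∂_V(Q_kA)(P)|² ≤ 2Σ_P|∂_V M_kA(P)|² + 2Σ_P|∂_V E_kA(P)|² ≤ 16‖D_UA‖² + (64(d−1)c_g² + 16d(1+ε_F)²c_E²) ε_F² ‖A‖²_{L²(Ω_k)}`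
(second term: `|∂_V E_kA(P)|² ≤ 4(1+ε_F)²Σ_{c∈∂P}|E_kA(c)|²`, each unit bond in `≤ 2(d−1)` plaquettes, then (R-M)).»  Its three inputs are
typed or displayed elsewhere on the row: the MAIN-PART letter (5.2) `Σ_P |∂_V M_kA(P)|² ≤ p_M‖D_UA‖² + q_M‖A‖²` (`…CovariantStokesCounting.
sum_sq_le_of_blockAverage_bound` with every count discharged by `…BlockSurfaceMultiplicity` ∕ `…BlockSurfaceCounting.sum_sq_le_twoScale`:
`p_M = 2`, `q_M = 16(d−1)c_g²ε_F²` — print allows `8` ∕ `32(d−1)c_g²ε_F²`), the (R-M) letter `Σ_c |E_kA(c)|² ≤ c_E²ε_F²‖A‖²_{L²(Ω_k)}` (memo §5.3,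
the note's ONE delicate reading — DISPLAYED), and the locality of the linearised covariant curl `|(∂_V B)(P)| ≤ (1+ε_F)·Σ_{c∈∂P}|B(c)|`
(four transported bonds, `|Ad(V)| ≤ 1 + ε_F`-type — DISPLAYED as the letter `ℓ`).  Its output is the `hF` hypothesis of
`…CurlFormEnergyDomination.h1_of_letters` (`F(QA) ≤ p·Dsq A + q·NΩ A`).  THIS FILE is that display as ONE inequality of the named letters —
currency-agnostic (the unit-lattice field space `V` is any additive type, the fine field space `W` any type, the plaquette functionals `X_P` are
only assumed subadditive in absolute value — linear maps and seminorms both qualify — and bond sizes enter through an abstract `sz`), then in the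
matrix currency of the consumer (`Q = M + E : Matrix m n ℝ`, `F := fun B ↦ Σ_P (X P B)²`) VERBATIM in `h1_of_letters`' `hF` shape.

WHAT IS PROVED ([folklore] real inequalities + two counts by name):
* §1 the split: `sq_le_two_sq_add` (`|z| ≤ |x| + |y|` ⊢ `z² ≤ 2x² + 2y²`), **`sum_sq_add_le`** (`X_P` subadditive in `|·|` ⊢
  `Σ_P X_P(B₁+B₂)² ≤ 2Σ_P X_P(B₁)² + 2Σ_P X_P(B₂)²`).
* §2 the remainder's curl form: **`sum_sq_le_of_local`** (`|X P| ≤ ℓ·Σ_{c∈inc P} s c`, `#inc P ≤ a`, `#{P : c ∈ inc P} ≤ b`, `ℓ ≥ 0` ⊢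
  `Σ_P X P² ≤ ℓ²ab·Σ_c (s c)²` — `pert_letter_of_local` BY NAME with `g = 0`), **`sum_sq_remainder_le`** (+ the (R-M) letter
  `Σ_c sz(EA) c² ≤ c_E·NΩ A` ⊢ `Σ_P X_P(EA)² ≤ ℓ²ab·c_E·NΩ A`).
* §3 **`curlForm_letter_of_split`** — THE DISPLAY: `Q A = M A + E A`, the main-part letter `Σ_P X_P(MA)² ≤ p_M·Dsq A + q_M·NΩ A`, §2's letters ⊢
  `∀ A, Σ_P X_P(QA)² ≤ 2p_M·Dsq A + (2q_M + 2ℓ²ab·c_E)·NΩ A`; **`curlForm_letter_of_split_mulVec`** — the same for `Q = M + E : Matrix m n ℝ`,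
  conclusion `∀ A, F (Q *ᵥ A) ≤ p * Dsq A + q * NΩ A` with `F := fun B ↦ Σ_P (X P B)²` — VERBATIM the `hF` of `h1_of_letters`;
  `curlForm_letter_of_flat` (`Q = M`, i.e. `E = 0` — the flat background `U = 1`, where (R-M) is exact: no factor `2`, `(p, q) = (p_M, q_M)`).
* §4 the unit-torus counts BY NAME: `card_image_four_le` (`a = 4`: a plaquette lists four bonds), **`sum_sq_le_of_local_torus`** (on `(ℤ∕N)^d`
  with `inc P` = the four bonds of `P`: `Σ_P X P² ≤ ℓ²·4·2(d−1)·Σ_c (s c)²`, `…TorusPlaquetteIncidence.card_plaquettes_through_bond_le` BY NAME),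
  `sum_sq_le_of_local_torus_four` (`d = 4`: `≤ 24ℓ²·Σ_c (s c)²`).
* §5 print's numbers: `p_print` (`2·8 = 16`), **`q_le_c3`** (with `ℓ = 1+ε_F`, `a = 4`, `b = 2(d−1)`, `c_E ↦ c_E²ε_F²`, `q_M = 32(d−1)c_g²ε_F²`:
  `q = (64(d−1)c_g² + 16(d−1)(1+ε_F)²c_E²)ε_F² ≤ c₃ε_F²`, `c₃ = 64(d−1)c_g² + 16d(1+ε_F)²c_E²` — the memo's `16d` is this file's `16(d−1)`
  rounded up), `kappa1_le_thirteen` (the SHARP main-part letter `p_M = 2` of `…BlockSurfaceCounting` gives `p = 4`, whence the consumer's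
  `κ₁ = (1−r)⁻¹(p(1+τc₀) + qc₀) ≤ 13` under the memo's side conditions, against `…CurlFormEnergyDomination.kappa1_le_forty`'s `40` at `p = 16`).
* §6 toy: one plaquette, one bond, `M = id`, `E = 0` — the display closes with `(p, q) = (2, 0)` (`example`).

NOT HERE (honest): the three letters BY VALUE — (5.2)'s `(p_M, q_M)` is the END of `…BlockSurfaceCounting` once `X_P`, `F = D_UA`, `A` are READ
in print's objects (no olean yet; not imported), (R-M)'s `c_E` (memo §5.3 ∕ §8.1: B7 (125), (134), (139)–(143); at one step the tree's
`B7Prop3GeneralLinearBound.norm_linQcov_sub_main_le` is the sup-norm form — the `k`-uniform `ℓ²` form is NOT in the tree), the curl's locality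
letter `ℓ = 1 + ε_F` ((π8), (R-V)); the `L²(Ω_k)` normalisation (`Dsq`, `NΩ` carry the fine measure `η^d` — definitional in the consumer's reading,
(A3) ∕ (A1c), NC-NE7b-α UNRULED); the junction with `…CurlFormEnergyDomination.h1_of_letters` BY NAME (one `have` once its olean exists — §3's
conclusion is its `hF` verbatim); anything of Bałaban's.  BY-NAME EFFECT ON THE WALL: NONE.  NE7b NOT PRINTED ∕ NOT PROVED; spine PROVED 0∕9;
rung (B)+1 on a FINITE torus — NOT infinite volume, NOT the mass gap, NOT Clay.
HONEST DEPENDENCY: continuum YM on T⁴ ⇐ BetaPertH ∧ nine spine estimates (0/9 proved); BetaPertH ⇐ (D1) ∧ (D4) ∧ CAP+tail; G-an2-4 gates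
asym, D1 and NE2/3/4.
-/

set_option autoImplicit false

open Finset Matrix
open scoped BigOperators

namespace Summit.QuantumFields.BalabanUV.T4Continuum.NE7b.AveragedCurlFormSplit

/-! ## §1 The split `F(B₁ + B₂) ≤ 2F(B₁) + 2F(B₂)` for a sum of squares of subadditive functionals -/

section Split

variable {Pl V : Type*} [Fintype Pl] [Add V]

/-- `|z| ≤ |x| + |y|` ⊢ `z² ≤ 2x² + 2y²`. [folklore] -/
theorem sq_le_two_sq_add {x y z : ℝ} (h : |z| ≤ |x| + |y|) : z ^ 2 ≤ 2 * x ^ 2 + 2 * y ^ 2 := by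
  have h1 : z ^ 2 ≤ (|x| + |y|) ^ 2 := by
    rw [← sq_abs z]
    exact pow_le_pow_left₀ (abs_nonneg z) h 2
  nlinarith [sq_abs x, sq_abs y, sq_nonneg (|x| - |y|)]

/-- **THE SPLIT**: for plaquette functionals subadditive in absolute value (`|X_P(B₁+B₂)| ≤ |X_P B₁| + |X_P B₂|` — linear maps, seminorms),
`Σ_P X_P(B₁+B₂)² ≤ 2Σ_P X_P(B₁)² + 2Σ_P X_P(B₂)²` — the memo's «`F(QA) ≤ 2Σ_P|∂_V M_kA(P)|² + 2Σ_P|∂_V E_kA(P)|²`». [folklore] -/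
theorem sum_sq_add_le (X : Pl → V → ℝ) (hsub : ∀ P B₁ B₂, |X P (B₁ + B₂)| ≤ |X P B₁| + |X P B₂|) (B₁ B₂ : V) :
    ∑ P, X P (B₁ + B₂) ^ 2 ≤ 2 * ∑ P, X P B₁ ^ 2 + 2 * ∑ P, X P B₂ ^ 2 := by
  rw [Finset.mul_sum, Finset.mul_sum, ← Finset.sum_add_distrib]
  exact Finset.sum_le_sum fun P _ => sq_le_two_sq_add (hsub P B₁ B₂)

end Split

/-! ## §2 The remainder's curl form: locality × double counting × (R-M) -/

section Remainder

variable {Pl C : Type*} [Fintype Pl] [Fintype C] [DecidableEq C]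

/-- **LOCAL LETTER ⟹ GLOBAL SQUARE SUM** (`…SqrtFormPerturbationLetters.pert_letter_of_local` BY NAME, with `g = 0`): `|X P| ≤ ℓ·Σ_{c∈inc P} s c`
for every plaquette, `#inc P ≤ a`, `#{P : c ∈ inc P} ≤ b`, `ℓ ≥ 0` ⊢ `Σ_P (X P)² ≤ ℓ²ab·Σ_c (s c)²` — the memo's «`|∂_V E_kA(P)|² ≤
4(1+ε_F)²Σ_{c∈∂P}|E_kA(c)|²`, each unit bond in `≤ 2(d−1)` plaquettes». [folklore] -/
theorem sum_sq_le_of_local (inc : Pl → Finset C) {a b : ℕ}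
    (ha : ∀ P, (inc P).card ≤ a) (hb : ∀ c, (univ.filter fun P => c ∈ inc P).card ≤ b)
    (X : Pl → ℝ) (s : C → ℝ) {ℓ : ℝ} (hℓ : 0 ≤ ℓ) (hloc : ∀ P, |X P| ≤ ℓ * ∑ c ∈ inc P, s c) :
    ∑ P, X P ^ 2 ≤ ℓ ^ 2 * a * b * ∑ c, s c ^ 2 := by
  have h := SqrtFormPerturbationLetters.pert_letter_of_local inc (fun P _ => X P) (fun _ _ => (0 : ℝ)) ha hb s
    (fun P => by
      rw [sub_zero]
      exact (hloc P).trans (mul_le_mul_of_nonneg_left (Finset.sum_le_sum fun c _ => le_abs_self (s c)) hℓ))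
  have hs : s ⬝ᵥ s = ∑ c, s c ^ 2 := by simp only [dotProduct, pow_two]
  simpa only [sub_zero, hs] using h

/-- **… COMPOSED WITH THE (R-M) LETTER**: with bond sizes `sz : V → C → ℝ` of unit-lattice fields, the locality letter `|X_P B| ≤ ℓ·Σ_{c∈inc P} sz B c`
and the remainder letter `Σ_c (sz (EA) c)² ≤ c_E·NΩ A` (print: `c_E ↦ c_E²ε_F²`, `NΩ A = ‖A‖²_{L²(Ω_k)}`) ⊢ `Σ_P X_P(EA)² ≤ ℓ²ab·c_E·NΩ A`. [folklore] -/
theorem sum_sq_remainder_le {V W : Type*} (inc : Pl → Finset C) {a b : ℕ}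
    (ha : ∀ P, (inc P).card ≤ a) (hb : ∀ c, (univ.filter fun P => c ∈ inc P).card ≤ b)
    (X : Pl → V → ℝ) (sz : V → C → ℝ) {ℓ : ℝ} (hℓ : 0 ≤ ℓ) (hloc : ∀ P B, |X P B| ≤ ℓ * ∑ c ∈ inc P, sz B c)
    (E : W → V) (NΩ : W → ℝ) {cE : ℝ} (hE : ∀ A, ∑ c, sz (E A) c ^ 2 ≤ cE * NΩ A) (A : W) :
    ∑ P, X P (E A) ^ 2 ≤ ℓ ^ 2 * a * b * cE * NΩ A := by
  have h1 := sum_sq_le_of_local inc ha hb (fun P => X P (E A)) (sz (E A)) hℓ fun P => hloc P (E A)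
  have h2 : ℓ ^ 2 * a * b * ∑ c, sz (E A) c ^ 2 ≤ ℓ ^ 2 * a * b * (cE * NΩ A) :=
    mul_le_mul_of_nonneg_left (hE A) (by positivity)
  calc ∑ P, X P (E A) ^ 2 ≤ ℓ ^ 2 * a * b * ∑ c, sz (E A) c ^ 2 := h1
    _ ≤ ℓ ^ 2 * a * b * (cE * NΩ A) := h2
    _ = ℓ ^ 2 * a * b * cE * NΩ A := by ring

end Remainder

/-! ## §3 The display: the letter `(p, q) = (2p_M, 2q_M + 2ℓ²ab·c_E)` of the consumer from the split -/

section Letter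

variable {Pl C : Type*} [Fintype Pl] [Fintype C] [DecidableEq C]

/-- **PROP. 5.4, FIRST DISPLAY — THE COVARIANT-STOKES-PLUS-(R-M) LETTER FROM THE SPLIT `Q = M + E`.**  Letters: the plaquette functionals
`X_P` subadditive in `|·|`; their locality `|X_P B| ≤ ℓ·Σ_{c∈inc P} sz B c` (`ℓ ≥ 0`) with the counts `#inc P ≤ a`, `#{P : c ∈ inc P} ≤ b`; the
MAIN-PART letter (5.2) `Σ_P X_P(MA)² ≤ p_M·Dsq A + q_M·NΩ A`; the (R-M) letter `Σ_c (sz (EA) c)² ≤ c_E·NΩ A`.  Conclusion: for every fine field `A`,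
`Σ_P X_P(QA)² ≤ 2p_M·Dsq A + (2q_M + 2ℓ²ab·c_E)·NΩ A`. [folklore] -/
theorem curlForm_letter_of_split {V W : Type*} [Add V]
    (X : Pl → V → ℝ) (hsub : ∀ P B₁ B₂, |X P (B₁ + B₂)| ≤ |X P B₁| + |X P B₂|)
    (inc : Pl → Finset C) {a b : ℕ}
    (ha : ∀ P, (inc P).card ≤ a) (hb : ∀ c, (univ.filter fun P => c ∈ inc P).card ≤ b)
    (sz : V → C → ℝ) {ℓ : ℝ} (hℓ : 0 ≤ ℓ) (hloc : ∀ P B, |X P B| ≤ ℓ * ∑ c ∈ inc P, sz B c)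
    (Q M E : W → V) (hQ : ∀ A, Q A = M A + E A) (Dsq NΩ : W → ℝ) {pM qM cE : ℝ}
    (hM : ∀ A, ∑ P, X P (M A) ^ 2 ≤ pM * Dsq A + qM * NΩ A)
    (hE : ∀ A, ∑ c, sz (E A) c ^ 2 ≤ cE * NΩ A) :
    ∀ A, ∑ P, X P (Q A) ^ 2 ≤ 2 * pM * Dsq A + (2 * qM + 2 * (ℓ ^ 2 * a * b * cE)) * NΩ A := by
  intro A
  rw [hQ A]
  have h1 := sum_sq_add_le X hsub (M A) (E A)
  have h2 := hM A
  have h3 := sum_sq_remainder_le inc ha hb X sz hℓ hloc E NΩ hE A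
  calc ∑ P, X P (M A + E A) ^ 2 ≤ 2 * ∑ P, X P (M A) ^ 2 + 2 * ∑ P, X P (E A) ^ 2 := h1
    _ ≤ 2 * (pM * Dsq A + qM * NΩ A) + 2 * (ℓ ^ 2 * a * b * cE * NΩ A) := by linarith
    _ = 2 * pM * Dsq A + (2 * qM + 2 * (ℓ ^ 2 * a * b * cE)) * NΩ A := by ring

/-- **THE SAME IN THE CONSUMER's MATRIX CURRENCY — VERBATIM the `hF` hypothesis of `…CurlFormEnergyDomination.h1_of_letters`**: unit-lattice
fields `m → ℝ`, fine fields `n → ℝ`, `Q = M + E : Matrix m n ℝ` (the (R-M) decomposition `Q_k(U) = M_k + E_k`), `F := fun B ↦ Σ_P (X P B)²`: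
`∀ A, F (Q *ᵥ A) ≤ p * Dsq A + q * NΩ A` with `p = 2p_M`, `q = 2q_M + 2ℓ²ab·c_E`. [folklore] -/
theorem curlForm_letter_of_split_mulVec {m n : Type*} [Fintype m] [Fintype n]
    (X : Pl → (m → ℝ) → ℝ) (hsub : ∀ P B₁ B₂, |X P (B₁ + B₂)| ≤ |X P B₁| + |X P B₂|)
    (inc : Pl → Finset C) {a b : ℕ}
    (ha : ∀ P, (inc P).card ≤ a) (hb : ∀ c, (univ.filter fun P => c ∈ inc P).card ≤ b)
    (sz : (m → ℝ) → C → ℝ) {ℓ : ℝ} (hℓ : 0 ≤ ℓ) (hloc : ∀ P B, |X P B| ≤ ℓ * ∑ c ∈ inc P, sz B c)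
    (Q M E : Matrix m n ℝ) (hQ : Q = M + E) (Dsq NΩ : (n → ℝ) → ℝ) {pM qM cE : ℝ}
    (hM : ∀ A, ∑ P, X P (M *ᵥ A) ^ 2 ≤ pM * Dsq A + qM * NΩ A)
    (hE : ∀ A, ∑ c, sz (E *ᵥ A) c ^ 2 ≤ cE * NΩ A) :
    ∀ A : n → ℝ, (fun B : m → ℝ => ∑ P, X P B ^ 2) (Q *ᵥ A)
      ≤ (2 * pM) * Dsq A + (2 * qM + 2 * (ℓ ^ 2 * a * b * cE)) * NΩ A := by
  intro A
  have h := curlForm_letter_of_split X hsub inc ha hb sz hℓ hloc (fun A => Q *ᵥ A) (fun A => M *ᵥ A) (fun A => E *ᵥ A)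
    (fun A => by rw [hQ, Matrix.add_mulVec]) Dsq NΩ hM hE A
  simpa only [mul_assoc] using h

/-- **AT THE FLAT BACKGROUND (`U = 1`: `E_k = 0`, `Q_k(1) = M_k` exactly — memo §5.3, [B5] (1.7)–(1.9))** no split is paid: `Q A = M A` and the
main-part letter give `(p, q) = (p_M, q_M)`. [folklore] -/
theorem curlForm_letter_of_flat {V W : Type*} (X : Pl → V → ℝ) (Q M : W → V) (hQ : ∀ A, Q A = M A)
    (Dsq NΩ : W → ℝ) {pM qM : ℝ} (hM : ∀ A, ∑ P, X P (M A) ^ 2 ≤ pM * Dsq A + qM * NΩ A) :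
    ∀ A, ∑ P, X P (Q A) ^ 2 ≤ pM * Dsq A + qM * NΩ A := by
  intro A
  rw [hQ A]
  exact hM A

end Letter

/-! ## §4 The counts `a = 4`, `b = 2(d−1)` on the unit torus `(ℤ∕N)^d` BY NAME

Sites `x : Fin d → ZMod N`, bonds `(x, μ)`, plaquettes `(x, ⟨(μ, ν), μ < ν⟩)`; the plaquette-to-bonds map `ι` is carried by its characterising
hypothesis (as in `…TorusPlaquetteIncidence`, inhabited there by `exists_plaquetteBonds`) and `inc P := univ.image (ι P)` is the set of the (at
most) four bonds of `P`. -/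

section Torus

variable {d N : ℕ}

/-- A plaquette lists at most four bonds: `#(univ.image (ι P)) ≤ 4`. [folklore] -/
theorem card_image_four_le {B : Type*} [DecidableEq B] (f : Fin 4 → B) : (univ.image f).card ≤ 4 :=
  Finset.card_image_le.trans (by rw [Finset.card_univ, Fintype.card_fin])

/-- **THE REMAINDER's CURL FORM ON THE UNIT TORUS** — §2 with `a = 4` (`card_image_four_le`) and `b = 2(d−1)`
(`…TorusPlaquetteIncidence.card_plaquettes_through_bond_le` BY NAME): `|X P| ≤ ℓ·Σ_{c ∈ bonds of P} s c` for every plaquette of `(ℤ∕N)^d`, `ℓ ≥ 0`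
⊢ `Σ_P (X P)² ≤ ℓ²·4·2(d−1)·Σ_c (s c)²`. [folklore] -/
theorem sum_sq_le_of_local_torus [NeZero N]
    (ι : (Fin d → ZMod N) × {a : Fin d × Fin d // a.1 < a.2} → Fin 4 → (Fin d → ZMod N) × Fin d)
    (hι : ∀ x a, ι (x, a) = ![(x, a.1.1), (x + Pi.single a.1.1 1, a.1.2), (x + Pi.single a.1.2 1, a.1.1), (x, a.1.2)])
    (X : (Fin d → ZMod N) × {a : Fin d × Fin d // a.1 < a.2} → ℝ) (s : (Fin d → ZMod N) × Fin d → ℝ) {ℓ : ℝ} (hℓ : 0 ≤ ℓ)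
    (hloc : ∀ P, |X P| ≤ ℓ * ∑ c ∈ univ.image (ι P), s c) :
    ∑ P, X P ^ 2 ≤ ℓ ^ 2 * (4 : ℕ) * ((2 * (d - 1) : ℕ) : ℝ) * ∑ c, s c ^ 2 :=
  sum_sq_le_of_local (fun P => univ.image (ι P)) (fun P => card_image_four_le (ι P))
    (fun c => TorusPlaquetteIncidence.card_plaquettes_through_bond_le ι hι c) X s hℓ hloc

/-- **AT `d = 4`: `Σ_P (X P)² ≤ 24ℓ²·Σ_c (s c)²`** (`4 · 6`: four bonds per plaquette, six plaquettes per bond). [folklore] -/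
theorem sum_sq_le_of_local_torus_four [NeZero N]
    (ι : (Fin 4 → ZMod N) × {a : Fin 4 × Fin 4 // a.1 < a.2} → Fin 4 → (Fin 4 → ZMod N) × Fin 4)
    (hι : ∀ x a, ι (x, a) = ![(x, a.1.1), (x + Pi.single a.1.1 1, a.1.2), (x + Pi.single a.1.2 1, a.1.1), (x, a.1.2)])
    (X : (Fin 4 → ZMod N) × {a : Fin 4 × Fin 4 // a.1 < a.2} → ℝ) (s : (Fin 4 → ZMod N) × Fin 4 → ℝ) {ℓ : ℝ} (hℓ : 0 ≤ ℓ)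
    (hloc : ∀ P, |X P| ≤ ℓ * ∑ c ∈ univ.image (ι P), s c) :
    ∑ P, X P ^ 2 ≤ 24 * ℓ ^ 2 * ∑ c, s c ^ 2 := by
  have h := sum_sq_le_of_local_torus ι hι X s hℓ hloc
  norm_num at h
  linarith

end Torus

/-! ## §5 Print's numbers: `p = 16`, `q ≤ c₃ε_F²`; the sharp main part's payoff `κ₁ ≤ 13` -/

section Print

/-- `p = 2p_M = 16` at print's `p_M = 8` (the memo's (5.2) constant; the tree's sharp count `…BlockSurfaceCounting` gives `p_M = 2`, `p = 4`). -/
theorem p_print : (2 : ℝ) * 8 = 16 := by norm_num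

/-- **`q ≤ c₃ε_F²`**: with print's letters `q_M = 32(d−1)c_g²ε_F²`, `ℓ = 1 + ε_F`, `a = 4`, `b = 2(d−1)`, `c_E ↦ c_E²ε_F²` the split's
`q = 2q_M + 2ℓ²ab·c_E²ε_F² = (64(d−1)c_g² + 16(d−1)(1+ε_F)²c_E²)ε_F²` is at most the memo's `c₃ε_F²`, `c₃ := 64(d−1)c_g² + 16d(1+ε_F)²c_E²`
(`d − 1 ≤ d`). [folklore] -/
theorem q_le_c3 {d : ℕ} (hd : 1 ≤ d) (cg cE εF : ℝ) :
    2 * (32 * ((d : ℝ) - 1) * cg ^ 2 * εF ^ 2) + 2 * ((1 + εF) ^ 2 * (4 : ℕ) * ((2 * (d - 1) : ℕ) : ℝ) * (cE ^ 2 * εF ^ 2))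
      ≤ (64 * ((d : ℝ) - 1) * cg ^ 2 + 16 * d * (1 + εF) ^ 2 * cE ^ 2) * εF ^ 2 := by
  have hcast : ((2 * (d - 1) : ℕ) : ℝ) = 2 * ((d : ℝ) - 1) := by
    rw [Nat.cast_mul, Nat.cast_sub hd]; norm_num
  rw [hcast]
  have h0 : 0 ≤ (1 + εF) ^ 2 * (cE ^ 2 * εF ^ 2) := by positivity
  push_cast
  nlinarith

/-- **THE SHARP MAIN PART's PAYOFF**: at `p = 4` (`p_M = 2` from `…BlockSurfaceCounting`) the consumer's `κ₁ = (1−r)⁻¹(p(1+τc₀) + qc₀)` is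
`≤ 2·(4·(1 + ⅛) + 2) = 13` under the memo's side conditions `r ≤ ½`, `0 ≤ τc₀ ≤ ⅛`, `0 ≤ qc₀ ≤ 2` — against `40` at print's `p = 16`
(`…CurlFormEnergyDomination.kappa1_le_forty`). Zero weight for the wall; a constant of the (h1) slot only. [folklore] -/
theorem kappa1_le_thirteen {r c₀ τ q : ℝ} (hr : r ≤ 1 / 2) (hτc : 0 ≤ τ * c₀) (hτc' : τ * c₀ ≤ 1 / 8)
    (hqc : 0 ≤ q * c₀) (hqc' : q * c₀ ≤ 2) :
    (1 - r)⁻¹ * (4 * (1 + τ * c₀) + q * c₀) ≤ 13 := by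
  have h1r : 0 < 1 - r := by linarith
  have hinv : (1 - r)⁻¹ ≤ 2 := by
    rw [inv_le_comm₀ h1r (by norm_num : (0 : ℝ) < 2)]
    linarith
  have hb : 4 * (1 + τ * c₀) + q * c₀ ≤ 13 / 2 := by linarith
  have hb0 : 0 ≤ 4 * (1 + τ * c₀) + q * c₀ := by linarith
  calc (1 - r)⁻¹ * (4 * (1 + τ * c₀) + q * c₀) ≤ 2 * (13 / 2) := mul_le_mul hinv hb hb0 (by norm_num)
    _ = 13 := by norm_num

end Print

/-! ## §6 Toy: one plaquette, one bond, `M = id`, `E = 0` — `(p, q) = (2·1, 2·0 + 2·(1·1·1·0)) = (2, 0)` -/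

section Toy

/- `Pl = C = Fin 1`, `V = W = ℝ`, `X _ B = B`, `inc _ = {0}` (`a = b = 1`), `sz B _ = |B|`, `ℓ = 1`; `Q = M = id`, `E = 0`; `Dsq A = NΩ A = A²`,
`p_M = 1`, `q_M = 0`, `c_E = 0`: the display returns `Σ_P (QA)² ≤ 2·1·A² + (2·0 + 2·(1²·1·1·0))·A²`. -/
example : ∀ A : ℝ, ∑ _P : Fin 1, (fun (_ : Fin 1) (B : ℝ) => B) 0 ((fun A : ℝ => A) A) ^ 2
    ≤ 2 * 1 * (fun A : ℝ => A ^ 2) A + (2 * 0 + 2 * ((1 : ℝ) ^ 2 * (1 : ℕ) * (1 : ℕ) * 0)) * (fun A : ℝ => A ^ 2) A :=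
  curlForm_letter_of_split (Pl := Fin 1) (C := Fin 1) (fun _ B => B) (fun _ B₁ B₂ => abs_add_le B₁ B₂) (fun _ => {0})
    (fun _ => by simp) (fun c => by fin_cases c; decide) (fun B _ => |B|) zero_le_one
    (fun _ B => by simp) (fun A => A) (fun A => A) (fun _ => 0) (fun A => (add_zero A).symm)
    (fun A => A ^ 2) (fun A => A ^ 2) (fun A => by simp) (fun A => by simp)

end Toy

end Summit.QuantumFields.BalabanUV.T4Continuum.NE7b.AveragedCurlFormSplit
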